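import Mathlib
import HarnessLib
import HarnessLib.Audit
import Summits.BirchSwinnertonDyer.Statement
import Literature.NumberTheory.EllipticCurves.HuShuYin2019.SylvesterHeegnerHeightDisplay
import Literature.NumberTheory.EllipticCurves.LiLiuTian2024.CMRankOnePPart
import Literature.NumberTheory.EllipticCurves.Kobayashi2013.CMRankOnePPart
import Literature.NumberTheory.EllipticCurves.HeegnerPoints
import Literature.NumberTheory.EllipticCurves.NonvanishingTwists
import Literature.NumberTheory.EllipticCurves.ModularCurve
import Literature.NumberTheory.EllipticCurves.Rank1Residual.Typed.Basic
import Summits.BirchSwinnertonDyer.BirchSwinnertonDyer.Theorems.CMRungInputs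
import HarnessLib.Audit.Status.Attr
-- import Summits.BirchSwinnertonDyer.BirchSwinnertonDyer.Theorems.SylvesterTwoHeegnerIndexThmCDefs dropped: it (transitively) imports this route file — proofs used by `closes`/`_holds` must live in a module that does not import the Theses file

/-!
Route: SylvesterTwoHeegnerIndex

# Route SylvesterTwoHeegnerIndex — BSD at p = 2 for the Sylvester cube-sum curves E_p via the 2-adic
valuation of the CM Heegner index

It suffices to show, on the Hu–Shu–Yin family 𝒞_HSY (`E_p : x³ + y³ = p`, i.e. the global minimal
models of
`cubeSumCurve p`, `p ≡ 4, 7 (mod 9)` prime with `3 ∉ 𝔽_p^{×3}`, all of analytic rank one), the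
`2`-ADIC HEEGNER-INDEX IDENTITY
`ord₂ 𝔮(E_p, K, P) = ord₂ #Ш(E_p)` for the CM Heegner-index quotient `P2.cmHeegnerIndexQuotient` of
`P2/CMRankOneAtTwoHeegnerIndex.lean`, split as its two inequalities: the LOWER half
`HeegnerIndexLowerAtTwoHSY`
(`ord₂ 𝔮 ≤ ord₂ #Ш`, Gross–Zagier + explicit `2`-part of the BSD quotient) and the UPPER half
`HeegnerIndexUpperAtTwoHSY` (`ord₂ #Ш ≤ ord₂ 𝔮`, a Kolyvagin-type bound AT `p = 2` for a CM curve).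
The route closes
the registered RUNG LEAF K7t `X12.CMAtTwo` (D-0061: `BSD(E_p, 2)` on 𝒞_HSY); the odd part of BSD for
𝒞_HSY is a
tree theorem (`X12/CubeSumSylvesterOddPart`).
Lean: `∀ (p : ℕ), p.Prime → (p % 9 = 4 ∨ p % 9 = 7) → (¬ ∃ x : ZMod p, x ^ 3 = 3) → ∀ (W :
WeierstrassCurve ℚ) [W.IsElliptic] [W.IsGloballyMinimal], (∃ C : WeierstrassCurve.VariableChange ℚ,
C • W = Literature.NumberTheory.EllipticCurves.HuShuYin2019.cubeSumCurve (p : ℚ)) → ∀ (N : ℕ)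
[NeZero N] (K : Type) [Field K] [NumberField K] (Dt :
Literature.NumberTheory.EllipticCurves.ModularForms.ModularParametrizationData W N) (H :
Literature.NumberTheory.EllipticCurves.HeegnerDatum N (NumberField.discr K)) (ι : K →+* ℂ) (P :
(W.baseChange K).toAffine.Point) (Wd : WeierstrassCurve ℚ) [Wd.IsElliptic] [Wd.IsGloballyMinimal]
(Cd : WeierstrassCurve.VariableChange ℚ) (k : ℕ), W.HasCM → W.analyticRank = 1 →
Literature.NumberTheory.EllipticCurves.IsImaginaryQuadratic K →
Literature.NumberTheory.EllipticCurves.SatisfiesHeegnerHypothesis N K →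
WeierstrassCurve.Affine.Point.map ι.toRatAlgHom P =
Literature.NumberTheory.EllipticCurves.ModularForms.heegnerPointComplex Dt H → (W.quadraticTwist
(NumberField.discr K : ℚ)).entireLFunction 1 ≠ 0 → Cd • W.quadraticTwist (NumberField.discr K : ℚ) =
Wd → (k = 1 ∨ k = 2) → (k = 2 ↔ ∀ y : W.toAffine.Point, ∃ Q : (W.baseChange K).toAffine.Point,
WeierstrassCurve.QuadraticDescent.incl K W y - (2 : ℤ) • Q ∈ AddCommGroup.torsion (W.baseChange
K).toAffine.Point) → padicValRat 2
(Summit.BirchSwinnertonDyer.Rank1Residual.P2.cmHeegnerIndexQuotient W K P Dt.c k Wd Cd.u) =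
padicValNat 2 (Nat.card W.sha)`

## Assembly
Pattern of the landed `P2.bsdTwoOn_cm_rankOne_of_heegnerIndexAtTwo`, restricted to 𝒞_HSY: for a
minimal model `B` of `E_p`,
analytic rank one from HSY + BF24 (`X12.CubeSumFamilies.bsdp_three_of_thm14'`), CM
(`X12.Sylvester.hasCM_of_model`), sign `−1`
by parity, a Heegner field `K` with `L(B^K,1) ≠ 0` (Waldspurger), a Heegner point (existence fact),
a minimal model of the twin
(`hasGlobalMinimalModel_rat_holds`), then `P2.bsdp_two_iff_cmHeegnerIndex` gives `k` and the iff,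
and
`le_antisymm (lower) (upper)` is `BSDp B 2`. Deciding theorem: `closes hlo hup hF :=
CMRungInputs.cmAtTwo_of_inputs hlo hup hF` (bridge `Theorems/CMRungInputs.lean`, landed p406906
commit 19c7e79e7ea1).

CLOSES_TARGET: closes rung K7t of BirchSwinnertonDyer: Summit.BirchSwinnertonDyer.Rank1Residual.X12.CMAtTwo (D-0061; not the summit Statement) — the deciding theorem of this route concludes that registered leaf instead of the Statement decl `BirchSwinnertonDyer` (class rung: servable and labelled, never counted as concluding the summit Statement).

Rationale: WHY THIS LINE. For a CM curve of analytic rank one the tree has the LANDED `L`-free equivalence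
`P2.bsdp_two_iff_cmHeegnerIndex` (p396383):
`BSD(E,2) ⟺ ord₂ 𝔮 = ord₂ #Ш(E)`, obtained by dividing the Gross–Zagier formula (GrossZagier1986
I.6.5/I.7.3) by the
rank-zero BSD formula of the twin `E^K` (Rubin / bsdTriple, CM) — so the `2`-part of BSD becomes a
statement about the
`2`-divisibility of ONE Heegner point, with no `2`-adic `L`-function, no main conjecture at `2` and
no `μ`-invariant
(every Iwasawa route at `p = 2` is blocked for CM curves: `2` ramifies or is inert in `ℚ(√−3)` and
the signed/BDP theory
needs `p` odd). On 𝒞_HSY the Heegner point is EXPLICIT (HuShuYin2019 Thm 1.4: `E_p(ℚ) ⊗ ℚ` generated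
by an explicit
Heegner point `y = R + \bar R` of controlled `2`- and `3`-divisibility; CST arXiv:1412.1950, Kriz
2020 arXiv:2002.04767
congruences for Heegner points of CM curves), and `E_p(ℚ)[2] = 0` (`x³ + y³ = p` has no rational
`2`-torsion), which is
what makes the `2`-descent over `K` (DescentDefectUnbounded's blind spot is Ш[2^∞] growth in
families — here Ш is finite
and the family is CM with fixed `2`-adic image) plausible. What it does that no open route does: no
listed BSD route touches
`p = 2`; LiLiuTian2024 / Kobayashi2013 / BurungaleFlach2024 all assume `p` odd.

RANKED CRUXES. #2 HeegnerIndexUpperAtTwoHSY (crux) — UPPER half on 𝒞_HSY — for `W` a global minimal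
model of `E_p` in 𝒞_HSY, every Heegner frame `(N, K, Dt, H, ι, P, Wd, Cd, k)` as in
`P2.CMRankOneHeegnerIndexUpperAtTwo` (K imaginary quadratic with the Heegner hypothesis, `P` a
Heegner point, `L(E^K,1) ≠ 0`, `Wd` a minimal model of the twin, `k ∈ {1,2}` the `2`-divisibility
flag of `E(ℚ)` in `E(K)`) satisfies `ord₂ #Ш(W) ≤ ord₂ 𝔮(W, K, P, c, k, Wd, u)` — the Kolyvagin
direction at `p = 2`. [difficulty: XL] (why it might fail: Kolyvagin's bound at p = 2 loses an
uncontrolled power of 2 (the Kolyvagin constant: image of Galois on E[2^n] is small for CM, and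
H¹(K(E[2^n])/K, E[2^n]) ≠ 0), so `ord₂ #Ш ≤ ord₂ 𝔮 + C` with C > 0 may be the truth for some p.)
[GrossZagier1986, Kolyvagin1990, HuShuYin2019, arXiv:1412.1950, arXiv:2002.04767]
#3 HeegnerIndexLowerAtTwoHSY (crux) — LOWER half on 𝒞_HSY — same frame, `ord₂ 𝔮(W, K, P, c, k, Wd,
u) ≤ ord₂ #Ш(W)`: the Heegner point is at least as `2`-divisible in `E(K)/tors` as
`#Ш[2^∞]·∏c_v·(Manin, u)` predicts — Gross–Zagier read `2`-adically with the explicit HSY point;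
equivalently the `2`-part of `#Ш ≥` the `2`-part of the BSD quotient. [difficulty: L] (why it might
fail: needs the exact power of 2 in the Manin constant, in `u`, in `c_2·c_3` (additive reduction at
2 and 3 for E_p) and in `[E(K):ℤy + E(ℚ) + E^K(ℚ)]`; HSY Thm 1.4 controls 2-divisibility of y only
up to the unproved `2 ∤ c_Manin` for these non-semistable curves.) [HuShuYin2019, GrossZagier1986,
Mazur1978, arXiv:1708.05266, arXiv:1707.05874]
#9 PublishedFactsTwo (support) — the published named facts of the consumer as ONE conjunction: HSY19
Thm 1.4 three-part product, CM rank-0 BSD triple (Rubin), entire `L`, LLT24 Thm 1.1 and Kob13 Cor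
1.4 (used only for `r_an = 1 ⇒` finiteness bookkeeping), Gross–Zagier and Kolyvagin as the tree's
`gross_zagier`/`kolyvagin` schemata, GZK rank conclusion, Waldspurger–BFH nonvanishing twist with
prescribed Heegner field, parity `(-1)^{r_an} = w`, existence of Heegner points — each a cite-tagged
Literature `Prop`, hypotheses `(h : X)`. [difficulty: provable-now] [HuShuYin2019, GrossZagier1986,
Kolyvagin1990, BumpFriedbergHoffstein1990, LiLiuTian2024, Kobayashi2013]

TWO-LAYER PLAN. HeegnerIndexUpperAtTwoHSY ⇐ (CM `2`-descent over `K`: `#Sel₂∞(E/K)` corank 1 and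
`Ш(E/K)[2^∞]` bounded by the index of the
Heegner point with an EXPLICIT constant `C(E_p) = 0`, using `E_p[2](K) = 0` and the fixed `2`-adic
image of the CM family) →
(descent from `K` to `ℚ`: `Ш(E/ℚ)[2^∞] ⊕ Ш(E^K/ℚ)[2^∞] ↪ Ш(E/K)[2^∞]` up to the `2`-torsion-free
kernel) → Upper.
HeegnerIndexLowerAtTwoHSY ⇐ (exact `2`-adic valuation of the Gross–Zagier constant for `E_p`: Manin
constant odd, `u`,
Tamagawa `c_2 c_3`) → (HSY Thm 1.4 divisibility of `y`) → Lower.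

KILL CRITERIA. One prime `p` in 𝒞_HSY with a CERTIFIED `#Ш(E_p)[2^∞]` (2-descent + Cassels–Tate,
bsd-cm-two data: 444/507 curves with
`p ≤ 20000` have certified generators) and a computed Heegner index of the wrong `2`-adic valuation
refutes the violated half
as typed (`refuted:HeegnerIndexUpperAtTwoHSY` or `…Lower…`) and closes the route; if only the upper
half dies with a bounded
defect `C`, pivot to a `C`-corrected identity plus a separate `2^C`-annihilation crux (new items,
same leaf). A proof of
BSD(E,2) for CM rank one in print (none as of 2026-08) moots the route (`superseded`).

NOT DECOMPOSED YET. The Kolyvagin-at-2 argument (upper half) is ONE crux on purpose: its internal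
split (Kolyvagin classes at 2 / Čebotarev
density with the CM image / the descent K → ℚ) is layer 2 after a prover fixes the Selmer structure.
The exact `2`-adic
constants (Manin, `u`, Tamagawa at 2 and 3 for `x³ + y³ = p`) are support lemmas on demand.

CHEAPEST FALSIFIER. `p = 13` (smallest 𝒞_HSY member with small height): compute the Heegner point `y
∈ E_13(ℚ)` (HSY §5 gives it), the index
`[E(ℚ)/tors : ℤy]`, `#Ш(E_13)[2] ` by 2-descent (expected trivial), and compare `ord₂ 𝔮` with `0`.
bsd-cm-two's certified
table (N6-TABLE §T6, 2-descent data for 616 Sylvester curves, referee-audited CLEAN 2026-08-25)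
already lists generators and
`#Ш[2]` for `p ≤ 20000`; the missing column is `ord₂` of the Heegner index — a one-curve PARI job.
Not run by me this session.

NUMBERS. 𝒞_HSY ∩ (3000, 20000]: 414 curves, all with certified generator and `Ш[2] = 0` where
computed (bsd-cm-two N5′-ext, referee
audit dd3e5cedd18e062d); HSY Thm 1.4: `ord₃` and `ord₂` statements for `L(E_p,1)`-type products on
`p ≡ 4,7 (9)`; `E_p(ℚ)_tors = 0`
for `p > 2` cube-free ≠ 1, 2 (Selmer 1951).

DEFINITION REQUESTS. None: `P2.cmHeegnerIndexQuotient`, `heegnerPointComplex`, `HeegnerDatum`,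
`QuadraticDescent.incl` are tree definitions; the leaf
`X12.CMAtTwo` is p405122.

Novelty: Searches (2026-08-25): lit search --hybrid "2-part of BSD CM elliptic curve rank one Heegner point
index Kolyvagin at p=2" (8 docs: ireland1982 pp 352–353, delbourgo2008 p16/34, cornell1997 p657,
cassels1991 p69, cremona1997 p4/35, burns2007 p537 — textbooks, no 2-part result for rank one CM);
lit search "cube sum Heegner point explicit Gross-Zagier 2-divisibility" (corpus:
paper:arxiv-1708.05266 HSY, paper:arxiv-1412.1950 CST, paper:arxiv-2002.04767 Kriz,
paper:arxiv-1707.05874; remote openalex/s2 HTTP 429); lit galaxy search "cube sum|Heegner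
index|2-part" --star all (8 hits, all junk: web PDFs unrelated); lean search
'cmHeegnerIndexQuotient' (tree P2 files only); ledger negatives --problem BirchSwinnertonDyer
(nothing at p = 2 for CM rank one).
Nearest prior art found: [corpus:paper:arxiv-1708.05266] HuShuYin2019 (explicit Gross–Zagier and the
3-PART of BSD for E_p, 2-divisibility of the Heegner point but no 2-part of Ш);
[corpus:paper:arxiv-1412.1950] Cai–Shu–Tian (cube sums, explicit GZ, 3-part);
[corpus:paper:arxiv-2002.04767] Kriz 2020 (supersingular main conjectures / Sylvester, p odd);
Kolyvagin1990 (the bound with an inexplicit constant at p = 2).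
Delta: turns BSD(E_p,2) into the 2-adic valuation identity of one explicit Heegner index via the
landed L-free equivalence, and asks for a Kolyvagin bound at p = 2 with constant zero on a CM family
with trivial rational 2-torsion — print has the 3-part only.
Claimed grade: new-combination  [refs: paper:arxiv-1708.05266, paper:arxiv-1412.1950, paper:arxiv-2002.04767, paper:arxiv-1707.05874, HuShuYin2019, Kolyvagin1990]

Barriers (technique_class: heegner-points, explicit-gross-zagier, two-descent-cm): - technique_class: heegner-points, explicit-gross-zagier, two-descent-cm
- Literature.Barriers.BirchSwinnertonDyer.HeegnerPointBarrier: inside its technique class AND inside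
its admissible regime by design — the barrier blocks Heegner-point / Kolyvagin-system conclusions in
analytic rank ≥ 2 (the Heegner class is torsion there); every 𝒞_HSY curve has analytic rank exactly
1 (HSY Thm 1.4 + BF24, invoked by name in PublishedFactsTwo), the Heegner point `P` is non-torsion
by Gross–Zagier, and no rank ≥ 2 statement is drawn. What the barrier does NOT give is the 2-PART of
the index [E(ℚ) : ℤP] — the two cruxes ARE that 2-adic index statement (upper = Kolyvagin-type bound
at p = 2 with the CM 2-adic image, lower = 2-adic Gross–Zagier / main-conjecture equality at the
supersingular prime 2); said honestly: index-free uses of Heegner points cannot reach BSD₂, and the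
bet is that the explicit cube-sum Heegner construction (Sylvester/Satgé/DV/HSY) controls the 2-part
on this family.
- Literature.Barriers.BirchSwinnertonDyer.HeegnerPointBarrierNarrow: same placement against the
audited Narrow entry (CM points as the point supply, level N_E, conductor 1): the supply is used
only in rank one where it is non-torsion; the crux content is the 2-adic divisibility ν₂(P₀) of the
supplied point versus #Ш[2^∞]·∏c_ℓ, which the Narrow barrier does not quantify over.
- Literature.Barriers.BirchSwinnertonDyer.SelmerRankBarrier: discharged — Ш(E_p) is finite and rank
E_p(ℚ) = 1 = r_an (GZK on 𝒞_HSY),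

sub-problem: BirchSwinnertonDyer · status: open · opened planner-bsd-cm-plan-g10-0 2026-08-25T21:22:34Z · rev 18 · ledger route-BirchSwinnertonDyer-SylvesterTwoHeegnerIndex
GENERATED by the gate from the ledger (D-0016/17). Provers cite these decls: `theorem foo : Summit.BirchSwinnertonDyer.BirchSwinnertonDyer.Theses.SylvesterTwoHeegnerIndex.<Decl> := …` in Summits/BirchSwinnertonDyer/BirchSwinnertonDyer/Theorems/<Name>.lean.
-/

namespace Summit.BirchSwinnertonDyer.BirchSwinnertonDyer.Theses.SylvesterTwoHeegnerIndex

open scoped BigOperators Topology Manifold Classical MeasureTheory ProbabilityTheory Matrix InnerProductSpace ComplexConjugate ContinuousMap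
open Filter Set Function TopologicalSpace MeasureTheory

attribute [summit_statement] _root_.BirchSwinnertonDyer
attribute [summit_statement] _root_.Summit.BirchSwinnertonDyer.Rank1Residual.X12.CMAtTwo

open Literature

/-- item stmt-BirchSwinnertonDyer-19725 · crux · rank 2 · SPLIT (gen 10) into HSYPointTwoDivisibleSevenModNine, TwoAdicPairHSYOfFactsPlusOfThmC, UpperOffV0HSYPlus + glue HeegnerIndexUpperOfPartsPlusHSY · direct attempts still welcome (low priority) · by planner
why it might fail: Off 𝒱₀ (Ш(E_p)[2] ≠ 0 or Ш(E_{3p²})[2] ≠ 0: 465 members p ≤ 2·10⁵) the sharp constant-zero 2-adic Kolyvagin bound ord₂#Ш(B)[2^∞] + ord₂#Ш(A)[2^∞] ≤ 2n is not in print at p = 2 for ℤ[ω]-CM (W. Zhang 2014 is p ≥ 5 ordinary); one member with #Ш(E_p)[2^∞] = 16 > 2^{2n} would refute it.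
sources: HuShuYin2019, Kolyvagin1990, GrossZagier1986, arXiv:1010.2431
earlier split gen 7: HSYPointTwoDivisibleSevenModNine, TwoAdicPairHSYOfFactsPlusOfThmC, UpperOffV0HSYPlus — retired stmt-BirchSwinnertonDyer-19790, stmt-BirchSwinnertonDyer-19791, stmt-BirchSwinnertonDyer-19792, stmt-BirchSwinnertonDyer-19793
earlier split gen 8: HSYPointTwoDivisibleSevenModNine, TwoAdicPairHSYOfFactsPlusOfThmC, UpperOffV0HSYPlus — retired stmt-BirchSwinnertonDyer-19794, stmt-BirchSwinnertonDyer-19795, stmt-BirchSwinnertonDyer-19796, stmt-BirchSwinnertonDyer-19797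
earlier split gen 9: HSYPointTwoDivisibleSevenModNine, TwoAdicPairHSYOfFactsPlusOfThmC, UpperOffV0HSYPlus — retired stmt-BirchSwinnertonDyer-19798, stmt-BirchSwinnertonDyer-19799, stmt-BirchSwinnertonDyer-19800, stmt-BirchSwinnertonDyer-19801
retired/moot children: HSYPointTwoDivisibleSevenModNine [retired: ∀ (p : ℕ), p.Prime → p % 9 = 7 → (¬ ∃ x : ZMod p, x ^ 3 = 3) → ∀ (A B : Weierstr]; TwoAdicPairHSYOfFactsPlusOfThmC [retired: ((Literature.NumberTheory.EllipticCurves.HuShuYin2019.thm14_threePart_product ∧ ]; UpperOffV0HSYPlus [retired: ((Literature.NumberTheory.EllipticCurves.HuShuYin2019.thm14_threePart_product ∧ ]; HeegnerIndexUpperOfPartsPlusHSY [retired: HSYPointTwoDivisibleSevenModNine → TwoAdicPairHSYOfFactsPlusOfThmC → UpperOffV0H]; HSYPointTwoDivisibleSevenModNine [retired: ∀ (p : ℕ), p.Prime → p % 9 = 7 → (¬ ∃ x : ZMod p, x ^ 3 = 3) → ∀ (A B : Weierstr]; TwoAdicPairHSYOfFactsPlusOfThmC [retired: ((Literature.NumberTheory.EllipticCurves.HuShuYin2019.thm14_threePart_product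 ∧ ]; UpperOffV0HSYPlus [retired: ((Literature.NumberTheory.EllipticCurves.HuShuYin2019.thm14_threePart_product ∧ ]; HeegnerIndexUpperOfPartsPlusHSY [retired: HSYPointTwoDivisibleSevenModNine → TwoAdicPairHSYOfFactsPlusOfThmC → UpperOffV0H]
[crux, facts-plus TWIN of 19476 (D75/D107 doctrine; 19476 → aside)] the Euler-system half
MissingUpperBoundAt (E_p) 2 on 𝒞_HSY GRANTED PublishedFactsTwoPlus. Split at once (E2) into
HSYPointTwoDivisibleSevenModNine (memo Thm C) / TwoAdicPairHSYOfFactsPlusOfThmC (closable now) /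
UpperOffV0HSYPlus, glue by p431798/p433825's upperOfFacts_of_twoAdicPair_of_offV0. CARRIERS (J ask
(5), j-addendum-2): the binders `∃ C : VariableChange ℚ, C • B = cubeSumCurve p` / `… = cubeSumCurve
(3p²)` with [IsElliptic] [IsGloballyMinimal] are INHABITED —
`X12.CubeSumSylvesterOddPart.sylvesterScale_smul` (sylvesterCurve p := [0,0,p,0,−7p²] ≅ cubeSumCurve
p), `X12.CubeSumFamilies.isElliptic_cubeSumCurve`,
`X12.CubeSumFamilies.exists_isGloballyMinimal_model`, displayed per member in
Theorems/SylvesterTwoHeegnerIndexUpperInstances.lean (`upper_sylvesterCurve_seven/_thirteen`). -/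
@[route_item "route-BirchSwinnertonDyer-SylvesterTwoHeegnerIndex", crux]
def HeegnerIndexUpperAtTwoHSYOfFactsPlus : Prop :=
  ((Literature.NumberTheory.EllipticCurves.HuShuYin2019.thm14_threePart_product ∧ Literature.NumberTheory.EllipticCurves.bsdTriple_of_hasCM_of_L_one_ne_zero ∧ WeierstrassCurve.hasEntireLFunction_rat ∧ Literature.NumberTheory.EllipticCurves.LiLiuTian2024.thm11_bsdp_of_cm_rank_one ∧ Literature.NumberTheory.EllipticCurves.Kobayashi2013.cor14_bsdp_of_cm_rank_one ∧ (∀ (N : ℕ) [NeZero N] (W : WeierstrassCurve ℚ) (K : Type) [Field K] [NumberField K], Literature.NumberTheory.EllipticCurves.gross_zagier N W K) ∧ (∀ (N : ℕ) [NeZero N] (W : WeierstrassCurve ℚ) (K : Type) [Field K] [NumberField K], Literature.NumberTheory.EllipticCurves.kolyvagin N W K) ∧ Literature.NumberTheory.EllipticCurves.rank_eq_analyticRank_of_analyticRank_le_one ∧ Literature.NumberTheory.EllipticCurves.waldspurger_exists_heegnerField_twist_ne_zero ∧ (∀ W : WeierstrassCurve ℚ, W.even_analyticRank_iff) ∧ (∀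 (W : WeierstrassCurve ℚ) (K : Type) [Field K] [NumberField K], Literature.NumberTheory.EllipticCurves.exists_isHeegnerPoint W K)) ∧ Literature.NumberTheory.EllipticCurves.HuShuYin2019.shaAnPair_mul_height_eq_two_zpow_mul_height) → ∀ (p : ℕ), p.Prime → (p % 9 = 4 ∨ p % 9 = 7) → (¬ ∃ x : ZMod p, x ^ 3 = 3) → ∀ (W : WeierstrassCurve ℚ) [W.IsElliptic] [W.IsGloballyMinimal], (∃ C : WeierstrassCurve.VariableChange ℚ, C • W = Literature.NumberTheory.EllipticCurves.HuShuYin2019.cubeSumCurve (p : ℚ)) → ∀ (N : ℕ) [NeZero N] (K : Type) [Field K] [NumberField K] (Dt : Literature.NumberTheory.EllipticCurves.ModularForms.ModularParametrizationData W N) (H : Literature.NumberTheory.EllipticCurves.HeegnerDatum N (NumberField.discr K)) (ι : K →+* ℂ) (P : (W.baseChange K).toAffine.Point) (Wd : WeierstrassCurve ℚ) [Wd.IsElliptic] [Wd.IsGloballyMinimal] (Cd : WeierstrassCurve.VariableChange ℚ) (k : ℕ), W.HasCM → W.analyticRank = 1 → Literature.NumberTheory.EllipticCurves.IsImaginaryQuadratic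 K → Literature.NumberTheory.EllipticCurves.SatisfiesHeegnerHypothesis N K → WeierstrassCurve.Affine.Point.map ι.toRatAlgHom P = Literature.NumberTheory.EllipticCurves.ModularForms.heegnerPointComplex Dt H → (W.quadraticTwist (NumberField.discr K : ℚ)).entireLFunction 1 ≠ 0 → Cd • W.quadraticTwist (NumberField.discr K : ℚ) = Wd → (k = 1 ∨ k = 2) → (k = 2 ↔ ∀ y : W.toAffine.Point, ∃ Q : (W.baseChange K).toAffine.Point, WeierstrassCurve.QuadraticDescent.incl K W y - (2 : ℤ) • Q ∈ AddCommGroup.torsion (W.baseChange K).toAffine.Point) → (padicValNat 2 (Nat.card W.sha) : ℤ) ≤ padicValRat 2 (Summit.BirchSwinnertonDyer.Rank1Residual.P2.cmHeegnerIndexQuotient W K P Dt.c k Wd Cd.u)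

-- parent: HeegnerIndexUpperAtTwoHSYOfFactsPlus · child (gen 10)
/--     item stmt-BirchSwinnertonDyer-19802 · crux · rank 201 · open
    parent: HeegnerIndexUpperAtTwoHSYOfFactsPlus · by operator
    why it might fail: Memo Thm C rests on an explicit Shimura-reciprocity computation on X₀(243) for the class of (3) in Cl(𝒪_{9p}); a slip in the CM-point / Galois-action bookkeeping for one residue class of p mod 27 would leave Y_p 2-indivisible on a sub-family (an E-two-g4-1-type erratum already occurred once).
    sources: HuShuYin2019, Shimura1971, GrossZagier1986
[crux, the cell's own theorem — MEMO-bsd-cm-two §15 THM C «m(p) ≥ 1»: for p ≡ 7 (9) prime with 3 a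
non-cube mod p, Hu–Shu–Yin's point Y_p ∈ E_p(K) is 2-divisible modulo torsion (K = ℚ(ω)); refereed
memo v2.6 PASS, NOT in print, NOT kernel] body = bsd-cm-two's fact-free def verbatim. [E2 v2:
THEOREM C's body INLINED verbatim (fully-qualified names) because its home module
Theorems/SylvesterTwoHeegnerIndexThmCDefs imports the route file (cycle: ThmCDefs →
TwoAdicPairModelNonneg → TwoAdicPairEngine → Theses); definitionally equal to
SylvesterTwoNonneg.HSYPointTwoDivisibleSevenModNine (Iff.rfl), so every by-name theorem about
THEOREM C applies unchanged.] -/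
@[route_item "route-BirchSwinnertonDyer-SylvesterTwoHeegnerIndex", crux]
def HSYPointTwoDivisibleSevenModNine : Prop :=
  ∀ (p : ℕ), p.Prime → p % 9 = 7 → (¬ ∃ x : ZMod p, x ^ 3 = 3) → ∀ (A B : WeierstrassCurve ℚ) [A.IsElliptic] [A.IsGloballyMinimal] [B.IsElliptic] [B.IsGloballyMinimal], (∃ C : WeierstrassCurve.VariableChange ℚ, C • B = Literature.NumberTheory.EllipticCurves.HuShuYin2019.cubeSumCurve (p : ℚ)) → (∃ C : WeierstrassCurve.VariableChange ℚ, C • A = Literature.NumberTheory.EllipticCurves.HuShuYin2019.cubeSumCurve (3 * (p : ℚ) ^ 2)) → ∀ (qB qA : ℚ), Literature.NumberTheory.EllipticCurves.shaAn B = (qB : ℂ) → Literature.NumberTheory.EllipticCurves.shaAn A = (qA : ℂ) → ∀ (K : Type) [Field K] [NumberField K] (ω : K), ω ^ 2 + ω + 1 = 0 → Module.finrank ℚ K = 2 → ∀ (P₀ : B.toAffine.Point), ¬ IsOfFinAddOrder (WeierstrassCurve.QuadraticDescent.incl K B P₀) → (∀ Q : B.toAffine.Point, ∃ m : ℤ,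 IsOfFinAddOrder (WeierstrassCurve.QuadraticDescent.incl K B Q - m • WeierstrassCurve.QuadraticDescent.incl K B P₀)) → ∀ (Y : (B.baseChange K).toAffine.Point), ((qB * qA : ℚ) : ℝ) * WeierstrassCurve.Affine.Point.canonicalHeight (WeierstrassCurve.QuadraticDescent.incl K B P₀) = (2 : ℝ) ^ (-2 : ℤ) * WeierstrassCurve.Affine.Point.canonicalHeight Y → ∃ Y' T' : (B.baseChange K).toAffine.Point, IsOfFinAddOrder T' ∧ Y = (2 : ℤ) • Y' + T'

-- parent: HeegnerIndexUpperAtTwoHSYOfFactsPlus · child (gen 10)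
/--     item stmt-BirchSwinnertonDyer-19803 · crux · rank 202 · closed · proved by Summit.BirchSwinnertonDyer.BirchSwinnertonDyer.Theorems.twoAdicPairHSYOfFactsPlusOfThmC_proof (prover)
    parent: HeegnerIndexUpperAtTwoHSYOfFactsPlus · by operator
    why it might fail: It cannot beyond its antecedents: the closing term is bsd-cm-two's landed assembly; content risk sits in the Cor 4.4 fact (print) and memo Thm C (sibling crux).
    sources: HuShuYin2019
[crux, closable NOW] 19580's 2-adic pair statement GRANTED PublishedFactsTwoPlus and memo Thm C:
closes verbatim by x1b GEN 49's landed assembly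
`SylvesterTwoThmCAssembly.twoAdicPairHSY_of_heightDisplay_of_thmC` (p456911 ACCEPTED b636b3e33d41;
D115 first-live-claimant) — closer term `fun hFP hT =>
SylvesterTwoThmCAssembly.twoAdicPairHSY_of_heightDisplay_of_thmC hFP.2 hT` — itself composed of
two's `SylvesterTwoNonneg.exists_nat_padicValRat_two_eq_of_model_of_thmC` (p445456) and x1b's parity
`twoAdicPairHSY_parity` (p447552 ACCEPTED a565e05072df). CARRIERS (J ask (5), j-addendum-2): the
binders `∃ C : VariableChange ℚ, C • B = cubeSumCurve p` / `… = cubeSumCurve (3p²)` with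
[IsElliptic] [IsGloballyMinimal] are INHABITED — `X12.CubeSumSylvesterOddPart.sylvesterScale_smul`
(sylvesterCurve p := [0,0,p,0,−7p²] ≅ cubeSumCurve p),
`X12.CubeSumFamilies.isElliptic_cubeSumCurve`, `X12.CubeSumFamilies.exists_isGloballyMinimal_model`,
displayed per member in Theorems/SylvesterTwoHeegnerIndexUpperInstances.lean
(`upper_sylvesterCurve_seven/_thirteen`). -/
@[route_item "route-BirchSwinnertonDyer-SylvesterTwoHeegnerIndex"]
def TwoAdicPairHSYOfFactsPlusOfThmC : Prop :=
  ((Literature.NumberTheory.EllipticCurves.HuShuYin2019.thm14_threePart_product ∧ Literature.NumberTheory.EllipticCurves.bsdTriple_of_hasCM_of_L_one_ne_zero ∧ WeierstrassCurve.hasEntireLFunction_rat ∧ Literature.NumberTheory.EllipticCurves.LiLiuTian2024.thm11_bsdp_of_cm_rank_one ∧ Literature.NumberTheory.EllipticCurves.Kobayashi2013.cor14_bsdp_of_cm_rank_one ∧ (∀ (N : ℕ) [NeZero N] (W : WeierstrassCurve ℚ) (K : Type) [Field K] [NumberField K], Literature.NumberTheory.EllipticCurves.gross_zagier N W K) ∧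 (∀ (N : ℕ) [NeZero N] (W : WeierstrassCurve ℚ) (K : Type) [Field K] [NumberField K], Literature.NumberTheory.EllipticCurves.kolyvagin N W K) ∧ Literature.NumberTheory.EllipticCurves.rank_eq_analyticRank_of_analyticRank_le_one ∧ Literature.NumberTheory.EllipticCurves.waldspurger_exists_heegnerField_twist_ne_zero ∧ (∀ W : WeierstrassCurve ℚ, W.even_analyticRank_iff) ∧ (∀ (W : WeierstrassCurve ℚ) (K : Type) [Field K] [NumberField K], Literature.NumberTheory.EllipticCurves.exists_isHeegnerPoint W K)) ∧ Literature.NumberTheory.EllipticCurves.HuShuYin2019.shaAnPair_mul_height_eq_two_zpow_mul_height) → ((∀ (p : ℕ), p.Prime → p % 9 = 7 → (¬ ∃ x : ZMod p, x ^ 3 = 3) → ∀ (A B : WeierstrassCurve ℚ) [A.IsElliptic] [A.IsGloballyMinimal] [B.IsElliptic] [B.IsGloballyMinimal], (∃ C : WeierstrassCurve.VariableChange ℚ, C • B = Literature.NumberTheory.EllipticCurves.HuShuYin2019.cubeSumCurve (p : ℚ)) → (∃ C : WeierstrassCurve.VariableChange ℚ, C • A = Literature.NumberTheory.EllipticCurves.HuShuYin2019.cubeSumCurve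 (3 * (p : ℚ) ^ 2)) → ∀ (qB qA : ℚ), Literature.NumberTheory.EllipticCurves.shaAn B = (qB : ℂ) → Literature.NumberTheory.EllipticCurves.shaAn A = (qA : ℂ) → ∀ (K : Type) [Field K] [NumberField K] (ω : K), ω ^ 2 + ω + 1 = 0 → Module.finrank ℚ K = 2 → ∀ (P₀ : B.toAffine.Point), ¬ IsOfFinAddOrder (WeierstrassCurve.QuadraticDescent.incl K B P₀) → (∀ Q : B.toAffine.Point, ∃ m : ℤ, IsOfFinAddOrder (WeierstrassCurve.QuadraticDescent.incl K B Q - m • WeierstrassCurve.QuadraticDescent.incl K B P₀)) → ∀ (Y : (B.baseChange K).toAffine.Point), ((qB * qA : ℚ) : ℝ) * WeierstrassCurve.Affine.Point.canonicalHeight (WeierstrassCurve.QuadraticDescent.incl K B P₀) = (2 : ℝ) ^ (-2 : ℤ) * WeierstrassCurve.Affine.Point.canonicalHeight Y → ∃ Y' T' : (B.baseChange K).toAffine.Point, IsOfFinAddOrder T' ∧ Y = (2 : ℤ) • Y' + T')) → ∀ (p : ℕ), p.Prime → (p % 9 = 4 ∨ p % 9 = 7) → (¬ ∃ x : ZMod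 p, x ^ 3 = 3) → ∀ (A B : WeierstrassCurve ℚ) [A.IsElliptic] [A.IsGloballyMinimal] [B.IsElliptic] [B.IsGloballyMinimal], (∃ C : WeierstrassCurve.VariableChange ℚ, C • B = Literature.NumberTheory.EllipticCurves.HuShuYin2019.cubeSumCurve (p : ℚ)) → (∃ C : WeierstrassCurve.VariableChange ℚ, C • A = Literature.NumberTheory.EllipticCurves.HuShuYin2019.cubeSumCurve (3 * (p : ℚ) ^ 2)) → ∃ qB qA : ℚ, Literature.NumberTheory.EllipticCurves.shaAn B = (qB : ℂ) ∧ Literature.NumberTheory.EllipticCurves.shaAn A = (qA : ℂ) ∧ qB * qA ≠ 0 ∧ ∃ n : ℕ, padicValRat 2 (qB * qA) = 2 * n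

-- `TwoAdicPairHSYOfFactsPlusOfThmC` holds: proved by `Summit.BirchSwinnertonDyer.BirchSwinnertonDyer.Theorems.twoAdicPairHSYOfFactsPlusOfThmC_proof` (its module imports this route file, so no `_holds` link can be stated here).

-- parent: HeegnerIndexUpperAtTwoHSYOfFactsPlus · child (gen 10)
/--     item stmt-BirchSwinnertonDyer-19804 · crux · rank 203 · open
    parent: HeegnerIndexUpperAtTwoHSYOfFactsPlus · by operator
    why it might fail: Same as 19581: a member off 𝒱₀ with ord₂#Ш(E_p)[2^∞] + ord₂#Ш(E_{3p²})[2^∞] > 2n (first informative rows: the (ℤ/4)²-members p = 18913, 30109, …) refutes it; no Kolyvagin system at p = 2 for ℤ[ω]-CM is in print.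
    sources: Kolyvagin1990, HuShuYin2019, arXiv:1010.2431
[crux, facts-plus twin of 19581 (→ aside)] off-𝒱₀ sharp 2-adic Kolyvagin bound for the HSY pair
GRANTED PublishedFactsTwoPlus — the genuinely open Euler-system content at p = 2 (unchanged from
19581; any proof of 19581 closes it by weakening). CARRIERS (J ask (5), j-addendum-2): the binders
`∃ C : VariableChange ℚ, C • B = cubeSumCurve p` / `… = cubeSumCurve (3p²)` with [IsElliptic]
[IsGloballyMinimal] are INHABITED — `X12.CubeSumSylvesterOddPart.sylvesterScale_smul`
(sylvesterCurve p := [0,0,p,0,−7p²] ≅ cubeSumCurve p),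
`X12.CubeSumFamilies.isElliptic_cubeSumCurve`, `X12.CubeSumFamilies.exists_isGloballyMinimal_model`,
displayed per member in Theorems/SylvesterTwoHeegnerIndexUpperInstances.lean
(`upper_sylvesterCurve_seven/_thirteen`). -/
@[route_item "route-BirchSwinnertonDyer-SylvesterTwoHeegnerIndex", crux]
def UpperOffV0HSYPlus : Prop :=
  ((Literature.NumberTheory.EllipticCurves.HuShuYin2019.thm14_threePart_product ∧ Literature.NumberTheory.EllipticCurves.bsdTriple_of_hasCM_of_L_one_ne_zero ∧ WeierstrassCurve.hasEntireLFunction_rat ∧ Literature.NumberTheory.EllipticCurves.LiLiuTian2024.thm11_bsdp_of_cm_rank_one ∧ Literature.NumberTheory.EllipticCurves.Kobayashi2013.cor14_bsdp_of_cm_rank_one ∧ (∀ (N : ℕ) [NeZero N] (W : WeierstrassCurve ℚ) (K : Type) [Field K] [NumberField K], Literature.NumberTheory.EllipticCurves.gross_zagier N W K) ∧ (∀ (N : ℕ) [NeZero N] (W : WeierstrassCurve ℚ) (K : Type) [Field K] [NumberField K], Literature.NumberTheory.EllipticCurves.kolyvagin N W K) ∧ Literature.NumberTheory.EllipticCurves.rank_eq_analyticRank_of_analyticRank_le_one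 ∧ Literature.NumberTheory.EllipticCurves.waldspurger_exists_heegnerField_twist_ne_zero ∧ (∀ W : WeierstrassCurve ℚ, W.even_analyticRank_iff) ∧ (∀ (W : WeierstrassCurve ℚ) (K : Type) [Field K] [NumberField K], Literature.NumberTheory.EllipticCurves.exists_isHeegnerPoint W K)) ∧ Literature.NumberTheory.EllipticCurves.HuShuYin2019.shaAnPair_mul_height_eq_two_zpow_mul_height) → ∀ (p : ℕ), p.Prime → (p % 9 = 4 ∨ p % 9 = 7) → (¬ ∃ x : ZMod p, x ^ 3 = 3) → ∀ (A B : WeierstrassCurve ℚ) [A.IsElliptic] [A.IsGloballyMinimal] [B.IsElliptic] [B.IsGloballyMinimal], (∃ C : WeierstrassCurve.VariableChange ℚ, C • B = Literature.NumberTheory.EllipticCurves.HuShuYin2019.cubeSumCurve (p : ℚ)) → (∃ C : WeierstrassCurve.VariableChange ℚ, C • A = Literature.NumberTheory.EllipticCurves.HuShuYin2019.cubeSumCurve (3 * (p : ℚ) ^ 2)) → ¬ (Nat.card (AddCommGroup.primaryComponent B.sha 2) = 1 ∧ Nat.card (AddCommGroup.primaryComponent A.sha 2) = 1) → Literature.NumberTheory.EllipticCurves.Rank1Residual.Typed.MissingUpperBoundAt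 B 2

-- parent: HeegnerIndexUpperAtTwoHSYOfFactsPlus · glue (gen 10)
/--     item stmt-BirchSwinnertonDyer-19805 · support · rank 204 · closed · proved by Summit.BirchSwinnertonDyer.BirchSwinnertonDyer.Theorems.heegnerIndexUpperOfPartsPlusHSY_proof (prover)
    parent: HeegnerIndexUpperAtTwoHSYOfFactsPlus · GLUE: children ⟹ parent · by operator
HSYPointTwoDivisibleSevenModNine → TwoAdicPairHSYOfFactsPlusOfThmC → UpperOffV0HSYPlus →
HeegnerIndexUpperAtTwoHSYOfFactsPlus: `fun hT hP hO hFP =>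
(SylvesterTwoUpper.upperOfFacts_of_twoAdicPair_of_offV0 (hP hFP hT) (fun _ => hO hFP)) hFP.1`
(p431798's glue theorem: section binder hBC = the fact-free pair statement, hoff = PublishedFactsTwo
→ off-𝒱₀ bound; then apply the resulting HeegnerIndexUpperAtTwoHSYOfFacts to the F-part of hFP).
Closes by a five-line Theorems file. -/
@[route_item "route-BirchSwinnertonDyer-SylvesterTwoHeegnerIndex"]
def HeegnerIndexUpperOfPartsPlusHSY : Prop :=
  HSYPointTwoDivisibleSevenModNine → TwoAdicPairHSYOfFactsPlusOfThmC → UpperOffV0HSYPlus → HeegnerIndexUpperAtTwoHSYOfFactsPlus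

-- `HeegnerIndexUpperOfPartsPlusHSY` holds: proved by `Summit.BirchSwinnertonDyer.BirchSwinnertonDyer.Theorems.heegnerIndexUpperOfPartsPlusHSY_proof` (its module imports this route file, so no `_holds` link can be stated here).

/-- item stmt-BirchSwinnertonDyer-19477 · crux · rank 3 · SPLIT (gen 1) into LowerOnV0HSY, LowerOffV0HSY + glue HeegnerIndexLowerOfPartsHSY · direct attempts still welcome (low priority) · by planner
why it might fail: = the main-conjecture half of BSD₂ on 𝒞_HSY: where HSY's point is 2-divisible beyond the prediction nothing in print forces Ш(E_p)[2] ≠ 0 (Kolyvagin-conjecture direction at p = 2, ℤ[ω]-CM, 2 inert); also needs the exact 2-power of the Manin constant, u and c₃·c_p.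
sources: HuShuYin2019, GrossZagier1986, Mazur1978, arXiv:1708.05266, arXiv:1707.05874
[crux] D82 (a) (planner g14; hand k7t-c3 verdict «misstated as filed», VERDICT-19230.md): the LOWER
half on 𝒞_HSY — `ord₂ 𝔮(W, K, P, c, k, Wd, u) ≤ ord₂ #Ш(W)` in every Heegner frame (the Heegner
point is at least as 2-divisible in E(K)/tors as #Ш[2^∞]·∏c_v·(Manin, u) predicts; Gross–Zagier read
2-adically with the explicit HSY point) — GRANTED the route's published facts (antecedent = the body
of `PublishedFactsTwo` verbatim). Facts-conditional TWIN of `HeegnerIndexLowerAtTwoHSY` (stmt-19230,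
now aside), same statement defect as 19229. Content (k7t-c3 p417655
`heegnerIndexLowerAtTwoHSY_iff_missingLowerBoundAt_onFamily`): modulo the facts the twin IS the
main-conjecture half `Typed.MissingLowerBoundAt W 2` on 𝒞_HSY; in two's Thm B′ currency `2·ord₂ r(p)
+ i ≤ ord₂(#Ш(E_p)·#Ш(E_{3p²}))` — trivial wherever HSY's reduced point is 2-indivisible (all 101
certified 𝒰 members), content = «extra 2-divisibility of the Heegner point forces Ш»
(Kolyvagin-conjecture direction at 2 for ℤ[ω]-CM, 2 inert; nothing in print — W. Zhang CJM 2014 is p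
≥ 5 ordinary). Strict-Selmer form: registered stubs `stub_strictSelmerLowerAtTwo` /
`stub_strictSelmerLeShaAtTwo` modulo GZK (p417881). Everything lande -/
@[route_item "route-BirchSwinnertonDyer-SylvesterTwoHeegnerIndex", crux]
def HeegnerIndexLowerAtTwoHSYOfFacts : Prop :=
  (Literature.NumberTheory.EllipticCurves.HuShuYin2019.thm14_threePart_product ∧ Literature.NumberTheory.EllipticCurves.bsdTriple_of_hasCM_of_L_one_ne_zero ∧ WeierstrassCurve.hasEntireLFunction_rat ∧ Literature.NumberTheory.EllipticCurves.LiLiuTian2024.thm11_bsdp_of_cm_rank_one ∧ Literature.NumberTheory.EllipticCurves.Kobayashi2013.cor14_bsdp_of_cm_rank_one ∧ (∀ (N : ℕ) [NeZero N] (W : WeierstrassCurve ℚ) (K : Type) [Field K] [NumberField K], Literature.NumberTheory.EllipticCurves.gross_zagier N W K) ∧ (∀ (N : ℕ) [NeZero N] (W : WeierstrassCurve ℚ) (K : Type) [Field K] [NumberField K], Literature.NumberTheory.EllipticCurves.kolyvagin N W K) ∧ Literature.NumberTheory.EllipticCurves.rank_eq_analyticRank_of_analyticRank_le_one ∧ Literature.NumberTheory.EllipticCurves.waldspurger_exists_heegnerField_twist_ne_zero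 ∧ (∀ W : WeierstrassCurve ℚ, W.even_analyticRank_iff) ∧ (∀ (W : WeierstrassCurve ℚ) (K : Type) [Field K] [NumberField K], Literature.NumberTheory.EllipticCurves.exists_isHeegnerPoint W K)) → ∀ (p : ℕ), p.Prime → (p % 9 = 4 ∨ p % 9 = 7) → (¬ ∃ x : ZMod p, x ^ 3 = 3) → ∀ (W : WeierstrassCurve ℚ) [W.IsElliptic] [W.IsGloballyMinimal], (∃ C : WeierstrassCurve.VariableChange ℚ, C • W = Literature.NumberTheory.EllipticCurves.HuShuYin2019.cubeSumCurve (p : ℚ)) → ∀ (N : ℕ) [NeZero N] (K : Type) [Field K] [NumberField K] (Dt : Literature.NumberTheory.EllipticCurves.ModularForms.ModularParametrizationData W N) (H : Literature.NumberTheory.EllipticCurves.HeegnerDatum N (NumberField.discr K)) (ι : K →+* ℂ) (P : (W.baseChange K).toAffine.Point) (Wd : WeierstrassCurve ℚ) [Wd.IsElliptic] [Wd.IsGloballyMinimal] (Cd : WeierstrassCurve.VariableChange ℚ) (k : ℕ), W.HasCM → W.analyticRank = 1 → Literature.NumberTheory.EllipticCurves.IsImaginaryQuadratic K → Literature.NumberTheory.EllipticCurves.SatisfiesHeegnerHypothesis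 N K → WeierstrassCurve.Affine.Point.map ι.toRatAlgHom P = Literature.NumberTheory.EllipticCurves.ModularForms.heegnerPointComplex Dt H → (W.quadraticTwist (NumberField.discr K : ℚ)).entireLFunction 1 ≠ 0 → Cd • W.quadraticTwist (NumberField.discr K : ℚ) = Wd → (k = 1 ∨ k = 2) → (k = 2 ↔ ∀ y : W.toAffine.Point, ∃ Q : (W.baseChange K).toAffine.Point, WeierstrassCurve.QuadraticDescent.incl K W y - (2 : ℤ) • Q ∈ AddCommGroup.torsion (W.baseChange K).toAffine.Point) → padicValRat 2 (Summit.BirchSwinnertonDyer.Rank1Residual.P2.cmHeegnerIndexQuotient W K P Dt.c k Wd Cd.u) ≤ padicValNat 2 (Nat.card W.sha)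

-- parent: HeegnerIndexLowerAtTwoHSYOfFacts · child (gen 1)
/--     item stmt-BirchSwinnertonDyer-19891 · crux · rank 301 · open
    parent: HeegnerIndexLowerAtTwoHSYOfFacts · by planner
    why it might fail: It is the 2-primitivity of an explicit Heegner point on an infinite family: one [1,1,0]-member with #Ш_an(E_p) even refutes it (and BSD); no mechanism bounds m(p) from above (memo two §22.3 (a)–(g): m is a class-group function of p, not a congruence function).
    sources: HuShuYin2019, GrossZagier1986, BurungaleFlach2024, Miller2011LMS
[crux, child of 19477 — the 𝒱₀ LAYER of the LOWER half] granted the published facts (body of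
`PublishedFactsTwo`), for every member/partner pair (B ≅ E_p, A ≅ E_{3p²} minimal) with Ш(B)[2^∞] =
1 ∧ Ш(A)[2^∞] = 1, the main-conjecture half `MissingLowerBoundAt B 2` (ord₂ #Ш_an(E_p) ≤ ord₂
#Ш(E_p) = 0) — equivalently (p471972 `SylvesterTwoLowerSplit.lowerOnV0_iff_pairLeZero` /
`missingLowerBoundAt_iff_shaAn_leZero_onV0`) ord₂(#Ш_an(B)·#Ш_an(A)) ≤ 0, i.e. Hu–Shu–Yin's
ℤ[ω]-Heegner point Y has the MINIMAL 2-divisibility 2(m(p)+i/2) = 0 wherever both 2-Selmer groups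
are minimal (memo two N7/R78; under `TwoAdicPairHSY` ⟺ n(p) = 0 on 𝒱₀,
`lowerOnV0_iff_pairUnit_of_twoAdicPair`). Per-member it is the CERT-row test «#Ш_an(E_p) odd on a
[1,1,0]-row» (507/507 p ≤ 2·10⁴; never observed to fail). OPEN as a class: Kolyvagin-conjecture /
m_∞ = 0 direction at the inert prime 2 for ℤ[ω]-CM (W. Zhang 2014 is p ≥ 5 ordinary; level raising
mod 2 obstructed, Chao Li IMRN 2019). -/
@[route_item "route-BirchSwinnertonDyer-SylvesterTwoHeegnerIndex", crux]
def LowerOnV0HSY : Prop :=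
  (Literature.NumberTheory.EllipticCurves.HuShuYin2019.thm14_threePart_product ∧ Literature.NumberTheory.EllipticCurves.bsdTriple_of_hasCM_of_L_one_ne_zero ∧ WeierstrassCurve.hasEntireLFunction_rat ∧ Literature.NumberTheory.EllipticCurves.LiLiuTian2024.thm11_bsdp_of_cm_rank_one ∧ Literature.NumberTheory.EllipticCurves.Kobayashi2013.cor14_bsdp_of_cm_rank_one ∧ (∀ (N : ℕ) [NeZero N] (W : WeierstrassCurve ℚ) (K : Type) [Field K] [NumberField K], Literature.NumberTheory.EllipticCurves.gross_zagier N W K) ∧ (∀ (N : ℕ) [NeZero N] (W : WeierstrassCurve ℚ) (K : Type) [Field K] [NumberField K], Literature.NumberTheory.EllipticCurves.kolyvagin N W K) ∧ Literature.NumberTheory.EllipticCurves.rank_eq_analyticRank_of_analyticRank_le_one ∧ Literature.NumberTheory.EllipticCurves.waldspurger_exists_heegnerField_twist_ne_zero ∧ (∀ W : WeierstrassCurve ℚ, W.even_analyticRank_iff) ∧ (∀ (W : WeierstrassCurve ℚ) (K : Type) [Field K] [NumberField K], Literature.NumberTheory.EllipticCurves.exists_isHeegnerPoint W K)) → ∀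 (p : ℕ), p.Prime → (p % 9 = 4 ∨ p % 9 = 7) → (¬ ∃ x : ZMod p, x ^ 3 = 3) → ∀ (A B : WeierstrassCurve ℚ) [A.IsElliptic] [A.IsGloballyMinimal] [B.IsElliptic] [B.IsGloballyMinimal], (∃ C : WeierstrassCurve.VariableChange ℚ, C • B = Literature.NumberTheory.EllipticCurves.HuShuYin2019.cubeSumCurve (p : ℚ)) → (∃ C : WeierstrassCurve.VariableChange ℚ, C • A = Literature.NumberTheory.EllipticCurves.HuShuYin2019.cubeSumCurve (3 * (p : ℚ) ^ 2)) → (Nat.card (AddCommGroup.primaryComponent B.sha 2) = 1 ∧ Nat.card (AddCommGroup.primaryComponent A.sha 2) = 1) → Literature.NumberTheory.EllipticCurves.Rank1Residual.Typed.MissingLowerBoundAt B 2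

-- parent: HeegnerIndexLowerAtTwoHSYOfFacts · child (gen 1)
/--     item stmt-BirchSwinnertonDyer-19892 · crux · rank 302 · open
    parent: HeegnerIndexLowerAtTwoHSYOfFacts · by planner
    why it might fail: A (ℤ/4)²-member with #Ш_an(E_p) = 64 but Ш(E_p)[2^∞] = (ℤ/4)² exactly (CTP on Sel₄ non-degenerate) refutes it; the two listed rows 140557, 381181 are exactly such candidates and need Magma's 8-descent / CTP(4-cover, 2-cover) to decide.
    sources: HuShuYin2019, GrossZagier1986, BurungaleFlach2024, Kolyvagin1990, Miller2011LMS
[crux, child of 19477 — the OFF-𝒱₀ LAYER of the LOWER half, mirror of `UpperOffV0HSY(Plus)`] granted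
the published facts, for every member/partner pair with Ш(B)[2^∞] ≠ 1 ∨ Ш(A)[2^∞] ≠ 1,
`MissingLowerBoundAt B 2` — equivalently (p471972 `SylvesterTwoLowerSplit.lowerOffV0_iff_pairBound`
= p457106's displayed hoff) the pair bound ord₂(#Ш_an(B)·#Ш_an(A)) ≤ ord₂#Ш(B)[2^∞] +
ord₂#Ш(A)[2^∞]: «extra 2-divisibility of Hu–Shu–Yin's point FORCES Ш» (2n(p) ≤ s_B + s_A). First
informative rows: the 79 (ℤ/4)²-members p ≤ 4·10⁵ (CERT79: 77 × #Ш_an = 16 consistent, p = 140557,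
381181 with #Ш_an = 64 predict Ш(E_p)[2^∞] = (ℤ/8)², undecided without an 8-descent). With
Cassels–Tate + `TwoAdicPairHSY` the one-bit form (constant 2¹) suffices
(`lowerOffV0_of_pairBound_add_one`). -/
@[route_item "route-BirchSwinnertonDyer-SylvesterTwoHeegnerIndex", crux]
def LowerOffV0HSY : Prop :=
  (Literature.NumberTheory.EllipticCurves.HuShuYin2019.thm14_threePart_product ∧ Literature.NumberTheory.EllipticCurves.bsdTriple_of_hasCM_of_L_one_ne_zero ∧ WeierstrassCurve.hasEntireLFunction_rat ∧ Literature.NumberTheory.EllipticCurves.LiLiuTian2024.thm11_bsdp_of_cm_rank_one ∧ Literature.NumberTheory.EllipticCurves.Kobayashi2013.cor14_bsdp_of_cm_rank_one ∧ (∀ (N : ℕ) [NeZero N] (W : WeierstrassCurve ℚ) (K : Type) [Field K] [NumberField K], Literature.NumberTheory.EllipticCurves.gross_zagier N W K) ∧ (∀ (N : ℕ) [NeZero N] (W : WeierstrassCurve ℚ) (K : Type) [Field K] [NumberField K], Literature.NumberTheory.EllipticCurves.kolyvagin N W K) ∧ Literature.NumberTheory.EllipticCurves.rank_eq_analyticRank_of_analyticRank_le_one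 ∧ Literature.NumberTheory.EllipticCurves.waldspurger_exists_heegnerField_twist_ne_zero ∧ (∀ W : WeierstrassCurve ℚ, W.even_analyticRank_iff) ∧ (∀ (W : WeierstrassCurve ℚ) (K : Type) [Field K] [NumberField K], Literature.NumberTheory.EllipticCurves.exists_isHeegnerPoint W K)) → ∀ (p : ℕ), p.Prime → (p % 9 = 4 ∨ p % 9 = 7) → (¬ ∃ x : ZMod p, x ^ 3 = 3) → ∀ (A B : WeierstrassCurve ℚ) [A.IsElliptic] [A.IsGloballyMinimal] [B.IsElliptic] [B.IsGloballyMinimal], (∃ C : WeierstrassCurve.VariableChange ℚ, C • B = Literature.NumberTheory.EllipticCurves.HuShuYin2019.cubeSumCurve (p : ℚ)) → (∃ C : WeierstrassCurve.VariableChange ℚ, C • A = Literature.NumberTheory.EllipticCurves.HuShuYin2019.cubeSumCurve (3 * (p : ℚ) ^ 2)) → ¬ (Nat.card (AddCommGroup.primaryComponent B.sha 2) = 1 ∧ Nat.card (AddCommGroup.primaryComponent A.sha 2) = 1) → Literature.NumberTheory.EllipticCurves.Rank1Residual.Typed.MissingLowerBoundAt B 2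

-- parent: HeegnerIndexLowerAtTwoHSYOfFacts · glue (gen 1)
/--     item stmt-BirchSwinnertonDyer-19893 · support · rank 303 · open
    parent: HeegnerIndexLowerAtTwoHSYOfFacts · GLUE: children ⟹ parent · by planner
LowerOnV0HSY → LowerOffV0HSY → HeegnerIndexLowerAtTwoHSYOfFacts: `fun hon hoff =>
SylvesterTwoLowerSplit.lowerOfFacts_of_onV0_of_offV0 hon hoff` (p471972
`Theorems/SylvesterTwoHeegnerIndexLowerSplit.lean`; the children are the two conjuncts of
`lowerOfFacts_iff_onV0_and_offV0`, which also proves the split LOSSLESS: parent ⟹ each child).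
Closes by a three-line Theorems file importing …Theorems.SylvesterTwoHeegnerIndexLowerSplit (if the
gate renders `PublishedFactsTwo` spelled out in the children, the term is unchanged: defeq). -/
@[route_item "route-BirchSwinnertonDyer-SylvesterTwoHeegnerIndex"]
def HeegnerIndexLowerOfPartsHSY : Prop :=
  LowerOnV0HSY → LowerOffV0HSY → HeegnerIndexLowerAtTwoHSYOfFacts

/-- item stmt-BirchSwinnertonDyer-19229 · aside · rank 2 · open · by planner
why it might fail: Kolyvagin's bound at p = 2 loses an uncontrolled power of 2 (the Kolyvagin constant: image of Galois on E[2^n] is small for CM, and H¹(K(E[2^n])/K, E[2^n]) ≠ 0), so `ord₂ #Ш ≤ ord₂ 𝔮 + C` with C > 0 may be the truth for some p.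
sources: GrossZagier1986, Kolyvagin1990, HuShuYin2019, arXiv:1412.1950, arXiv:2002.04767
[crux] UPPER half on 𝒞_HSY — for `W` a global minimal model of `E_p` in 𝒞_HSY, every Heegner frame
`(N, K, Dt, H, ι, P, Wd, Cd, k)` as in `P2.CMRankOneHeegnerIndexUpperAtTwo` (K imaginary quadratic
with the Heegner hypothesis, `P` a Heegner point, `L(E^K,1) ≠ 0`, `Wd` a minimal model of the twin,
`k ∈ {1,2}` the `2`-divisibility flag of `E(ℚ)` in `E(K)`) satisfies `ord₂ #Ш(W) ≤ ord₂ 𝔮(W, K, P,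
c, k, Wd, u)` — the Kolyvagin direction at `p = 2`. [difficulty: XL] -/
@[route_item "route-BirchSwinnertonDyer-SylvesterTwoHeegnerIndex"]
def HeegnerIndexUpperAtTwoHSY : Prop :=
  ∀ (p : ℕ), p.Prime → (p % 9 = 4 ∨ p % 9 = 7) → (¬ ∃ x : ZMod p, x ^ 3 = 3) → ∀ (W : WeierstrassCurve ℚ) [W.IsElliptic] [W.IsGloballyMinimal], (∃ C : WeierstrassCurve.VariableChange ℚ, C • W = Literature.NumberTheory.EllipticCurves.HuShuYin2019.cubeSumCurve (p : ℚ)) → ∀ (N : ℕ) [NeZero N] (K : Type) [Field K] [NumberField K] (Dt : Literature.NumberTheory.EllipticCurves.ModularForms.ModularParametrizationData W N) (H : Literature.NumberTheory.EllipticCurves.HeegnerDatum N (NumberField.discr K)) (ι : K →+* ℂ) (P : (W.baseChange K).toAffine.Point) (Wd : WeierstrassCurve ℚ) [Wd.IsElliptic] [Wd.IsGloballyMinimal] (Cd : WeierstrassCurve.VariableChange ℚ) (k : ℕ), W.HasCM → W.analyticRank = 1 → Literature.NumberTheory.EllipticCurves.IsImaginaryQuadratic K → Literature.NumberTheory.EllipticCurves.SatisfiesHeegnerHypothesis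 N K → WeierstrassCurve.Affine.Point.map ι.toRatAlgHom P = Literature.NumberTheory.EllipticCurves.ModularForms.heegnerPointComplex Dt H → (W.quadraticTwist (NumberField.discr K : ℚ)).entireLFunction 1 ≠ 0 → Cd • W.quadraticTwist (NumberField.discr K : ℚ) = Wd → (k = 1 ∨ k = 2) → (k = 2 ↔ ∀ y : W.toAffine.Point, ∃ Q : (W.baseChange K).toAffine.Point, WeierstrassCurve.QuadraticDescent.incl K W y - (2 : ℤ) • Q ∈ AddCommGroup.torsion (W.baseChange K).toAffine.Point) → (padicValNat 2 (Nat.card W.sha) : ℤ) ≤ padicValRat 2 (Summit.BirchSwinnertonDyer.Rank1Residual.P2.cmHeegnerIndexQuotient W K P Dt.c k Wd Cd.u)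

/-- item stmt-BirchSwinnertonDyer-19476 · aside · rank 2 · SPLIT (gen 1) into TwoAdicPairHSY, UpperOffV0HSY + glue HeegnerIndexUpperOfPartsHSY · direct attempts still welcome (low priority) · by planner
why it might fail: Off 𝒱₀ = {Ш(E_p)[2]=0 ∧ Ш(E_{3p²})[2]=0} it is a SHARP 2-adic Kolyvagin bound for a CM curve: the Galois image on E[2^n] is small and Kolyvagin's constant C(E) (ICM90 §2) is uncontrolled, so `ord₂ #Ш ≤ ord₂ 𝔮 + C`, C > 0, may be the truth for some p.
sources: GrossZagier1986, Kolyvagin1990, HuShuYin2019, arXiv:1412.1950, arXiv:2002.04767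
[crux] D82 (a) (planner g14; hands k7t-c2/k7t-c3 verdict «misstated as filed», evidence
VERDICT-19230.md / UPPER-CENSUS-k7t-c2.md): the UPPER half on 𝒞_HSY — `ord₂ #Ш(W) ≤ ord₂ 𝔮(W, K, P,
c, k, Wd, u)` in every Heegner frame, for every global minimal model `W` of `E_p : x³ + y³ = p` (p ≡
4, 7 mod 9 prime, 3 ∉ 𝔽_p^{×3}) — GRANTED the route's published facts (antecedent = the body of
`PublishedFactsTwo` verbatim: HSY Thm 1.4, Rubin's CM rank-0 triple, entire L, LLT24, Kob13, the
Gross–Zagier / Kolyvagin schemata, GZK, Waldspurger–BFH, parity, Heegner points). This is the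
facts-conditional TWIN of `HeegnerIndexUpperAtTwoHSY` (stmt-19229, now aside): the fact-free
original concludes on `padicValNat 2 (Nat.card W.sha)` and a Heegner index, meaningful only behind
`Finite Ш(E_p)` ∧ `rank E_p(ℚ) = 1`, which the kernel holds only as the named facts GZK / HSY Thm
1.4 — so no proof could close it as typed. Content (k7t-c2 p418375
`heegnerIndexUpperAtTwoHSY_iff_missingUpperBoundAt`): modulo the facts the twin IS the Euler-system
(Kolyvagin) half `Typed.MissingUpperBoundAt W 2` on the class; in strict-Selmer currency it is
exactly the registered XL stub `stub_strictSelmerUpperAtTwo` (p418830 `h -/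
@[route_item "route-BirchSwinnertonDyer-SylvesterTwoHeegnerIndex"]
def HeegnerIndexUpperAtTwoHSYOfFacts : Prop :=
  (Literature.NumberTheory.EllipticCurves.HuShuYin2019.thm14_threePart_product ∧ Literature.NumberTheory.EllipticCurves.bsdTriple_of_hasCM_of_L_one_ne_zero ∧ WeierstrassCurve.hasEntireLFunction_rat ∧ Literature.NumberTheory.EllipticCurves.LiLiuTian2024.thm11_bsdp_of_cm_rank_one ∧ Literature.NumberTheory.EllipticCurves.Kobayashi2013.cor14_bsdp_of_cm_rank_one ∧ (∀ (N : ℕ) [NeZero N] (W : WeierstrassCurve ℚ) (K : Type) [Field K] [NumberField K], Literature.NumberTheory.EllipticCurves.gross_zagier N W K) ∧ (∀ (N : ℕ) [NeZero N] (W : WeierstrassCurve ℚ) (K : Type) [Field K] [NumberField K], Literature.NumberTheory.EllipticCurves.kolyvagin N W K) ∧ Literature.NumberTheory.EllipticCurves.rank_eq_analyticRank_of_analyticRank_le_one ∧ Literature.NumberTheory.EllipticCurves.waldspurger_exists_heegnerField_twist_ne_zero ∧ (∀ W : WeierstrassCurve ℚ, W.even_analyticRank_iff) ∧ (∀ (W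 : WeierstrassCurve ℚ) (K : Type) [Field K] [NumberField K], Literature.NumberTheory.EllipticCurves.exists_isHeegnerPoint W K)) → ∀ (p : ℕ), p.Prime → (p % 9 = 4 ∨ p % 9 = 7) → (¬ ∃ x : ZMod p, x ^ 3 = 3) → ∀ (W : WeierstrassCurve ℚ) [W.IsElliptic] [W.IsGloballyMinimal], (∃ C : WeierstrassCurve.VariableChange ℚ, C • W = Literature.NumberTheory.EllipticCurves.HuShuYin2019.cubeSumCurve (p : ℚ)) → ∀ (N : ℕ) [NeZero N] (K : Type) [Field K] [NumberField K] (Dt : Literature.NumberTheory.EllipticCurves.ModularForms.ModularParametrizationData W N) (H : Literature.NumberTheory.EllipticCurves.HeegnerDatum N (NumberField.discr K)) (ι : K →+* ℂ) (P : (W.baseChange K).toAffine.Point) (Wd : WeierstrassCurve ℚ) [Wd.IsElliptic] [Wd.IsGloballyMinimal] (Cd : WeierstrassCurve.VariableChange ℚ) (k : ℕ), W.HasCM → W.analyticRank = 1 → Literature.NumberTheory.EllipticCurves.IsImaginaryQuadratic K → Literature.NumberTheory.EllipticCurves.SatisfiesHeegnerHypothesis N K → WeierstrassCurve.Affine.Point.map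 ι.toRatAlgHom P = Literature.NumberTheory.EllipticCurves.ModularForms.heegnerPointComplex Dt H → (W.quadraticTwist (NumberField.discr K : ℚ)).entireLFunction 1 ≠ 0 → Cd • W.quadraticTwist (NumberField.discr K : ℚ) = Wd → (k = 1 ∨ k = 2) → (k = 2 ↔ ∀ y : W.toAffine.Point, ∃ Q : (W.baseChange K).toAffine.Point, WeierstrassCurve.QuadraticDescent.incl K W y - (2 : ℤ) • Q ∈ AddCommGroup.torsion (W.baseChange K).toAffine.Point) → (padicValNat 2 (Nat.card W.sha) : ℤ) ≤ padicValRat 2 (Summit.BirchSwinnertonDyer.Rank1Residual.P2.cmHeegnerIndexQuotient W K P Dt.c k Wd Cd.u)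

-- parent: HeegnerIndexUpperAtTwoHSYOfFacts · child (gen 1)
/--     item stmt-BirchSwinnertonDyer-19580 · aside · rank 201 · open
    parent: HeegnerIndexUpperAtTwoHSYOfFacts · by planner
    why it might fail: Parity «ord₂(#Ш_an(E_p)·#Ш_an(E_{3p²})) even for ALL members» rests on the exact 2-power 2^α in HSY Cor 4.4 plus the u/k/Manin bookkeeping at 2 (memo Lemma 33.1; refereed, not kernel-checked): one miscounted local factor at 2 or 3 flips the parity on a sub-family (p ≡ 7 mod 9 vs 4 mod 9).
    sources: HuShuYin2019, GrossZagier1986, SilvermanAEC2009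
[crux, child of 19476 — the 𝒱₀ LAYER's input] the cell's 2-ADIC PAIR INDEX THEOREM for 𝒞_HSY: for
every member B ≅ E_p (p ≡ 4,7 mod 9, 3 ∉ 𝔽_p^{×3}) and every minimal partner A ≅ E_{3p²}, #Ш_an(B),
#Ш_an(A) are rational, their product is non-zero and ord₂(#Ш_an(B)·#Ш_an(A)) is EVEN (= 2n, n = m(p)
+ i/2 the normalised 2-adic valuation of Hu–Shu–Yin's ℤ[ω]-Heegner index; MEMO-bsd-cm-two §15 Thm
B′/B″ + C, refereed PASS, NOT kernel-checked) — displayed verbatim as the section binder hBC of the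
landed `Theorems/SylvesterTwoHeegnerIndexUpperOnV0.lean` (p431798), which proves the 𝒱₀ layer
(Ш(B)[2^∞] = Ш(A)[2^∞] = 1 ⇒ MissingUpperBoundAt B 2) from it + HSY Thm 1.4 / Cor 4.4 + rank-0 CM
BSD + modularity. -/
@[route_item "route-BirchSwinnertonDyer-SylvesterTwoHeegnerIndex"]
def TwoAdicPairHSY : Prop :=
  ∀ (p : ℕ), p.Prime → (p % 9 = 4 ∨ p % 9 = 7) → (¬ ∃ x : ZMod p, x ^ 3 = 3) → ∀ (A B : WeierstrassCurve ℚ) [A.IsElliptic] [A.IsGloballyMinimal] [B.IsElliptic] [B.IsGloballyMinimal], (∃ C : WeierstrassCurve.VariableChange ℚ, C • B = Literature.NumberTheory.EllipticCurves.HuShuYin2019.cubeSumCurve (p : ℚ)) → (∃ C : WeierstrassCurve.VariableChange ℚ, C • A = Literature.NumberTheory.EllipticCurves.HuShuYin2019.cubeSumCurve (3 * (p : ℚ) ^ 2)) → ∃ qB qA : ℚ, Literature.NumberTheory.EllipticCurves.shaAn B = (qB : ℂ) ∧ Literature.NumberTheory.EllipticCurves.shaAn A = (qA : ℂ) ∧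 qB * qA ≠ 0 ∧ ∃ n : ℕ, padicValRat 2 (qB * qA) = 2 * n

-- parent: HeegnerIndexUpperAtTwoHSYOfFacts · child (gen 1)
/--     item stmt-BirchSwinnertonDyer-19581 · aside · rank 202 · open
    parent: HeegnerIndexUpperAtTwoHSYOfFacts · by planner
    why it might fail: SHARP (constant-zero) 2-adic Kolyvagin bound for the CM pair at p = 2: Kolyvagin/McCallum give ord_p #Ш ≤ 2·ord_p[E(K):ℤy_K] only for ODD p; at 2 the Selmer-structure/Čebotarev step loses a bounded power of 2, so Off-𝒱₀ members ((ℤ/4)² ↪ Ш, 14 below 10⁵, first 18913) may violate it (4-descent).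
    sources: Kolyvagin1990, McCallumLMS1991, Howard2004HeegnerKolyvagin, HuShuYin2019
[crux, child of 19476 — the OFF-𝒱₀ LAYER, XL] granted the published facts (body of
`PublishedFactsTwo`), for every member/partner pair (B ≅ E_p, A ≅ E_{3p²} minimal) with Ш(B)[2^∞] ≠
1 ∨ Ш(A)[2^∞] ≠ 1, the Euler-system half `MissingUpperBoundAt B 2` (ord₂ #Ш(E_p) ≤ ord₂ #Ш_an(E_p))
— equivalently (p431798 `upperOfFacts_iff_indexBound_of_twoAdicPair`) the SHARP constant-zero 2-adic
Kolyvagin bound ord₂#Ш(B)[2^∞] + ord₂#Ш(A)[2^∞] ≤ 2n for the pair; the first informative rows are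
the 14 members ≤ 10⁵ with (ℤ/4)² ↪ Ш(E_p) (p = 18913, 30109, …, kit j250796). Displayed verbatim as
the hypothesis `hoff` of the landed glue `SylvesterTwoUpper.upperOfFacts_of_twoAdicPair_of_offV0`. -/
@[route_item "route-BirchSwinnertonDyer-SylvesterTwoHeegnerIndex"]
def UpperOffV0HSY : Prop :=
  (Literature.NumberTheory.EllipticCurves.HuShuYin2019.thm14_threePart_product ∧ Literature.NumberTheory.EllipticCurves.bsdTriple_of_hasCM_of_L_one_ne_zero ∧ WeierstrassCurve.hasEntireLFunction_rat ∧ Literature.NumberTheory.EllipticCurves.LiLiuTian2024.thm11_bsdp_of_cm_rank_one ∧ Literature.NumberTheory.EllipticCurves.Kobayashi2013.cor14_bsdp_of_cm_rank_one ∧ (∀ (N : ℕ) [NeZero N] (W : WeierstrassCurve ℚ) (K : Type) [Field K] [NumberField K], Literature.NumberTheory.EllipticCurves.gross_zagier N W K) ∧ (∀ (N : ℕ) [NeZero N] (W : WeierstrassCurve ℚ) (K : Type) [Field K] [NumberField K], Literature.NumberTheory.EllipticCurves.kolyvagin N W K) ∧ Literature.NumberTheory.EllipticCurves.rank_eq_analyticRank_of_analyticRank_le_one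 ∧ Literature.NumberTheory.EllipticCurves.waldspurger_exists_heegnerField_twist_ne_zero ∧ (∀ W : WeierstrassCurve ℚ, W.even_analyticRank_iff) ∧ (∀ (W : WeierstrassCurve ℚ) (K : Type) [Field K] [NumberField K], Literature.NumberTheory.EllipticCurves.exists_isHeegnerPoint W K)) → ∀ (p : ℕ), p.Prime → (p % 9 = 4 ∨ p % 9 = 7) → (¬ ∃ x : ZMod p, x ^ 3 = 3) → ∀ (A B : WeierstrassCurve ℚ) [A.IsElliptic] [A.IsGloballyMinimal] [B.IsElliptic] [B.IsGloballyMinimal], (∃ C : WeierstrassCurve.VariableChange ℚ, C • B = Literature.NumberTheory.EllipticCurves.HuShuYin2019.cubeSumCurve (p : ℚ)) → (∃ C : WeierstrassCurve.VariableChange ℚ, C • A = Literature.NumberTheory.EllipticCurves.HuShuYin2019.cubeSumCurve (3 * (p : ℚ) ^ 2)) → ¬ (Nat.card (AddCommGroup.primaryComponent B.sha 2) = 1 ∧ Nat.card (AddCommGroup.primaryComponent A.sha 2) = 1) → Literature.NumberTheory.EllipticCurves.Rank1Residual.Typed.MissingUpperBoundAt B 2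

-- parent: HeegnerIndexUpperAtTwoHSYOfFacts · glue (gen 1)
/--     item stmt-BirchSwinnertonDyer-19582 · support · rank 203 · closed · proved by Summit.BirchSwinnertonDyer.BirchSwinnertonDyer.Theorems.SylvesterTwoUpperOfParts.sylvesterTwoHeegnerIndex_heegnerIndexUpperOfPartsHSY (prover)
    parent: HeegnerIndexUpperAtTwoHSYOfFacts · GLUE: children ⟹ parent · by planner
glue for the split of HeegnerIndexUpperAtTwoHSYOfFacts: the children imply the parent -/
@[route_item "route-BirchSwinnertonDyer-SylvesterTwoHeegnerIndex"]
def HeegnerIndexUpperOfPartsHSY : Prop :=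
  TwoAdicPairHSY → UpperOffV0HSY → HeegnerIndexUpperAtTwoHSYOfFacts

-- `HeegnerIndexUpperOfPartsHSY` holds: proved by `Summit.BirchSwinnertonDyer.BirchSwinnertonDyer.Theorems.SylvesterTwoUpperOfParts.sylvesterTwoHeegnerIndex_heegnerIndexUpperOfPartsHSY` (its module imports this route file, so no `_holds` link can be stated here).

/-- item stmt-BirchSwinnertonDyer-19230 · aside · rank 3 · open · by planner
why it might fail: needs the exact power of 2 in the Manin constant, in `u`, in `c_3·c_p` (additive at 3 and p; at 2 E_p is GOOD supersingular, c_2 = 1) and in `[E(K):ℤy + E(ℚ) + E^K(ℚ)]`; HSY Thm 1.4 controls 2-divisibility of y only up to the unproved `2 ∤ c_Manin` for these non-semistable curves.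
sources: HuShuYin2019, GrossZagier1986, Mazur1978, arXiv:1708.05266, arXiv:1707.05874
[crux] LOWER half on 𝒞_HSY — same frame, `ord₂ 𝔮(W, K, P, c, k, Wd, u) ≤ ord₂ #Ш(W)`: the Heegner
point is at least as `2`-divisible in `E(K)/tors` as `#Ш[2^∞]·∏c_v·(Manin, u)` predicts —
Gross–Zagier read `2`-adically with the explicit HSY point; equivalently the `2`-part of `#Ш ≥` the
`2`-part of the BSD quotient. [difficulty: L] -/
@[route_item "route-BirchSwinnertonDyer-SylvesterTwoHeegnerIndex"]
def HeegnerIndexLowerAtTwoHSY : Prop :=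
  ∀ (p : ℕ), p.Prime → (p % 9 = 4 ∨ p % 9 = 7) → (¬ ∃ x : ZMod p, x ^ 3 = 3) → ∀ (W : WeierstrassCurve ℚ) [W.IsElliptic] [W.IsGloballyMinimal], (∃ C : WeierstrassCurve.VariableChange ℚ, C • W = Literature.NumberTheory.EllipticCurves.HuShuYin2019.cubeSumCurve (p : ℚ)) → ∀ (N : ℕ) [NeZero N] (K : Type) [Field K] [NumberField K] (Dt : Literature.NumberTheory.EllipticCurves.ModularForms.ModularParametrizationData W N) (H : Literature.NumberTheory.EllipticCurves.HeegnerDatum N (NumberField.discr K)) (ι : K →+* ℂ) (P : (W.baseChange K).toAffine.Point) (Wd : WeierstrassCurve ℚ) [Wd.IsElliptic] [Wd.IsGloballyMinimal] (Cd : WeierstrassCurve.VariableChange ℚ) (k : ℕ), W.HasCM → W.analyticRank = 1 → Literature.NumberTheory.EllipticCurves.IsImaginaryQuadratic K → Literature.NumberTheory.EllipticCurves.SatisfiesHeegnerHypothesis N K → WeierstrassCurve.Affine.Point.map ι.toRatAlgHom P = Literature.NumberTheory.EllipticCurves.ModularForms.heegnerPointComplex Dt H → (W.quadraticTwist (NumberField.discr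 K : ℚ)).entireLFunction 1 ≠ 0 → Cd • W.quadraticTwist (NumberField.discr K : ℚ) = Wd → (k = 1 ∨ k = 2) → (k = 2 ↔ ∀ y : W.toAffine.Point, ∃ Q : (W.baseChange K).toAffine.Point, WeierstrassCurve.QuadraticDescent.incl K W y - (2 : ℤ) • Q ∈ AddCommGroup.torsion (W.baseChange K).toAffine.Point) → padicValRat 2 (Summit.BirchSwinnertonDyer.Rank1Residual.P2.cmHeegnerIndexQuotient W K P Dt.c k Wd Cd.u) ≤ padicValNat 2 (Nat.card W.sha)

/-- item stmt-BirchSwinnertonDyer-19231 · support · rank 9 · open · by planner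
sources: HuShuYin2019, GrossZagier1986, Kolyvagin1990, BumpFriedbergHoffstein1990, LiLiuTian2024, Kobayashi2013
[support] the published named facts of the consumer as ONE conjunction: HSY19 Thm 1.4 three-part
product, CM rank-0 BSD triple (Rubin), entire `L`, LLT24 Thm 1.1 and Kob13 Cor 1.4 (used only for
`r_an = 1 ⇒` finiteness bookkeeping), Gross–Zagier and Kolyvagin as the tree's
`gross_zagier`/`kolyvagin` schemata, GZK rank conclusion, Waldspurger–BFH nonvanishing twist with
prescribed Heegner field, parity `(-1)^{r_an} = w`, existence of Heegner points — each a cite-tagged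
Literature `Prop`, hypotheses `(h : X)`. [difficulty: provable-now] -/
@[route_item "route-BirchSwinnertonDyer-SylvesterTwoHeegnerIndex", crux]
def PublishedFactsTwo : Prop :=
  Literature.NumberTheory.EllipticCurves.HuShuYin2019.thm14_threePart_product ∧ Literature.NumberTheory.EllipticCurves.bsdTriple_of_hasCM_of_L_one_ne_zero ∧ WeierstrassCurve.hasEntireLFunction_rat ∧ Literature.NumberTheory.EllipticCurves.LiLiuTian2024.thm11_bsdp_of_cm_rank_one ∧ Literature.NumberTheory.EllipticCurves.Kobayashi2013.cor14_bsdp_of_cm_rank_one ∧ (∀ (N : ℕ) [NeZero N] (W : WeierstrassCurve ℚ) (K : Type) [Field K] [NumberField K], Literature.NumberTheory.EllipticCurves.gross_zagier N W K) ∧ (∀ (N : ℕ) [NeZero N] (W : WeierstrassCurve ℚ) (K : Type) [Field K] [NumberField K], Literature.NumberTheory.EllipticCurves.kolyvagin N W K) ∧ Literature.NumberTheory.EllipticCurves.rank_eq_analyticRank_of_analyticRank_le_one ∧ Literature.NumberTheory.EllipticCurves.waldspurger_exists_heegnerField_twist_ne_zero ∧ (∀ W : WeierstrassCurve ℚ,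 W.even_analyticRank_iff) ∧ (∀ (W : WeierstrassCurve ℚ) (K : Type) [Field K] [NumberField K], Literature.NumberTheory.EllipticCurves.exists_isHeegnerPoint W K)

/-- item stmt-BirchSwinnertonDyer-19273 · aside · rank 9 · open · by planner
sources: BCDTJAMS2001, GrossZagier1986
[support] entire continuation of L(E/ℚ, s) (modularity: Breuil–Conrad–Diamond–Taylor 2001 Thm A +
Hecke/Shimura), BY NAME — conjunct of MultConversePublishedInputsAtTwo (19185); same content, filed
so the head constant is item-stated (#15c one rule; cite_only dep) -/
@[route_item "route-BirchSwinnertonDyer-SylvesterTwoHeegnerIndex"]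
def EntireLFunctionRat : Prop :=
  WeierstrassCurve.hasEntireLFunction_rat

/-- item stmt-BirchSwinnertonDyer-19423 · aside · rank 9 · open · by planner
sources: Rubin1991, Kobayashi2013
[support, cite-level BY-NAME ALIAS of a published input — never a prover target; held]
Burungale–Flach 2024 Thm. 1.1 + Cor. 2 (with Rubin 1991 Thm. 12.3 at p ∤ #O_K^×): the full BSD
formula for CM elliptic curves over ℚ with L(E,1) ≠ 0 at EVERY prime p. Conjunct 2 of
`PublishedInputsFineSelmerCM` (stmt 19387; closes the CM rows of the U₀-ns child); filed under this
split ONLY to item-state the constant (unused by the glue). -/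
@[route_item "route-BirchSwinnertonDyer-SylvesterTwoHeegnerIndex"]
def PublishedInputCMRankZeroBSD : Prop :=
  Literature.NumberTheory.EllipticCurves.bsdTriple_of_hasCM_of_L_one_ne_zero

/-- item stmt-BirchSwinnertonDyer-19568 · aside · rank 9 · open · by planner
sources: HuShuYin2019
[aside] Hu–Shu–Yin, JLMS 100 (2019) Thm 1.4: the explicit 3-part / three-part product for the
Heegner point on E_p : x³ + y³ = p, p ≡ 4, 7 (mod 9) (`HuShuYin2019.thm14_threePart_product`) —
conjunct 1 of PublishedFactsTwo (19231), BY NAME. Banked context (D-0019 aside): never staffed, not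
progress, BC6-exempt; filed ONLY so the cite_only head constant is item-stated (gate5 #15c one rule;
staffable remedy); no crux statement / closes / tribunal / tribunal_fit change intended. -/
@[route_item "route-BirchSwinnertonDyer-SylvesterTwoHeegnerIndex"]
def HuShuYinThreePartProduct : Prop :=
  Literature.NumberTheory.EllipticCurves.HuShuYin2019.thm14_threePart_product

/-- item stmt-BirchSwinnertonDyer-19569 · aside · rank 9 · open · by planner
sources: LiLiuTian2024
[aside] Li–Liu–Tian 2024 Thm 1.1: the p-part of BSD for CM E/ℚ of analytic rank 1 at the primes it
covers (`LiLiuTian2024.thm11_bsdp_of_cm_rank_one`; used by the consumer only for r_an = 1 ⇒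
finiteness bookkeeping) — conjunct 4 of PublishedFactsTwo (19231), BY NAME. Banked context (D-0019
aside): never staffed, not progress, BC6-exempt; filed ONLY so the cite_only head constant is
item-stated (gate5 #15c one rule; staffable remedy). -/
@[route_item "route-BirchSwinnertonDyer-SylvesterTwoHeegnerIndex"]
def LiLiuTianCMRankOnePPart : Prop :=
  Literature.NumberTheory.EllipticCurves.LiLiuTian2024.thm11_bsdp_of_cm_rank_one

/-- item stmt-BirchSwinnertonDyer-19570 · aside · rank 9 · open · by planner
sources: Kobayashi2013
[aside] Kobayashi 2013 (Invent. Math. 191) Cor 1.4: the p-part of BSD for CM E/ℚ of analytic rank 1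
at good p ∤ 2N (`Kobayashi2013.cor14_bsdp_of_cm_rank_one`; finiteness bookkeeping only) — conjunct 5
of PublishedFactsTwo (19231), BY NAME. Banked context (D-0019 aside): never staffed, not progress,
BC6-exempt; filed ONLY so the cite_only head constant is item-stated (gate5 #15c one rule; staffable
remedy). -/
@[route_item "route-BirchSwinnertonDyer-SylvesterTwoHeegnerIndex"]
def KobayashiCMRankOnePPart : Prop :=
  Literature.NumberTheory.EllipticCurves.Kobayashi2013.cor14_bsdp_of_cm_rank_one

/-- item stmt-BirchSwinnertonDyer-19571 · aside · rank 9 · open · by planner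
sources: BumpFriedbergHoffstein1990, GrossZagier1986
[aside] Waldspurger 1985 / Bump–Friedberg–Hoffstein 1990 / Murty–Murty: existence of an imaginary
quadratic K satisfying the Heegner hypothesis for N with L(E^K, 1) ≠ 0
(`waldspurger_exists_heegnerField_twist_ne_zero`) — conjunct 9 of PublishedFactsTwo (19231), BY
NAME. Banked context (D-0019 aside): never staffed, not progress, BC6-exempt; filed ONLY so the
cite_only head constant is item-stated (gate5 #15c one rule; staffable remedy). -/
@[route_item "route-BirchSwinnertonDyer-SylvesterTwoHeegnerIndex"]
def WaldspurgerHeegnerFieldTwist : Prop :=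
  Literature.NumberTheory.EllipticCurves.waldspurger_exists_heegnerField_twist_ne_zero

/-- item stmt-BirchSwinnertonDyer-19572 · aside · rank 9 · open · by planner
sources: HuShuYin2019, Miller2011LMS
[aside] s_case decl for tribunal_fit (J K7t round-2 ask «s_case CMAtTwo|p=18913»): the rung leaf
`X12.CMAtTwo` restricted to its first content-bearing 𝒞_HSY member p = 18913 (#Ш_an(E_18913) = 16,
conductor 27·18913²; `SylvesterTwoLowerCert.hsy_18913`: prime, ≡ 4 mod 9, 3 not a cube). NOT a
theorem in the tree or in print: granted PublishedFactsTwo and the two displayed certificates it is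
⟺ ¬ 32 ∣ #Ш(E_18913)
(`…Theorems.SylvesterTwoLowerCert.sylvesterTwoHeegnerIndex_bsdTwo_iff_not_32_dvd_18913`), i.e.
Ш(E_18913)[2^∞] ≅ (ℤ/4)² exactly (a 4-Selmer / Cassels–Tate computation, hand k7t-c3 target). The
LOWER twin's witness `…sylvesterTwoHeegnerIndex_heegnerIndexLowerAtTwoHSY_18913` holds at this
member while S|p=18913 is open — the out-of-regime BC5 pairing. Banked context (D-0019 aside): never
staffed, not progress, BC6-exempt; no crux statement / closes / tribunal change. -/
@[route_item "route-BirchSwinnertonDyer-SylvesterTwoHeegnerIndex"]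
def CMAtTwoAt18913 : Prop :=
  ∀ (B : WeierstrassCurve ℚ) [B.IsElliptic] [B.IsGloballyMinimal], (∃ C : WeierstrassCurve.VariableChange ℚ, C • B = Literature.NumberTheory.EllipticCurves.HuShuYin2019.cubeSumCurve ((18913 : ℕ) : ℚ)) → Literature.NumberTheory.EllipticCurves.BSDp B 2

/-- item stmt-BirchSwinnertonDyer-19724 · support · rank 9 · open · by planner
sources: HuShuYin2019, GrossZagier1986, Kolyvagin1990
[support, published inputs] PublishedFactsTwo (19231) verbatim ∧ the Hu–Shu–Yin 2019 Cor 4.4 / (bsd)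
p.12 explicit Heegner-point L-value identity as the ONE named Literature fact
Literature.NumberTheory.EllipticCurves.HuShuYin2019.shaAnPair_mul_height_eq_two_zpow_mul_height (x1b
GEN 48, p443765 ACCEPTED 9288db3df34f). Imported complement of the facts-plus twins; never attacked. -/
@[route_item "route-BirchSwinnertonDyer-SylvesterTwoHeegnerIndex", crux]
def PublishedFactsTwoPlus : Prop :=
  (Literature.NumberTheory.EllipticCurves.HuShuYin2019.thm14_threePart_product ∧ Literature.NumberTheory.EllipticCurves.bsdTriple_of_hasCM_of_L_one_ne_zero ∧ WeierstrassCurve.hasEntireLFunction_rat ∧ Literature.NumberTheory.EllipticCurves.LiLiuTian2024.thm11_bsdp_of_cm_rank_one ∧ Literature.NumberTheory.EllipticCurves.Kobayashi2013.cor14_bsdp_of_cm_rank_one ∧ (∀ (N : ℕ) [NeZero N] (W : WeierstrassCurve ℚ) (K : Type) [Field K] [NumberField K], Literature.NumberTheory.EllipticCurves.gross_zagier N W K) ∧ (∀ (N : ℕ) [NeZero N] (W : WeierstrassCurve ℚ) (K : Type) [Field K] [NumberField K], Literature.NumberTheory.EllipticCurves.kolyvagin N W K) ∧ Literature.NumberTheory.EllipticCurves.rank_eq_analyticRank_of_analyticRank_le_one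 ∧ Literature.NumberTheory.EllipticCurves.waldspurger_exists_heegnerField_twist_ne_zero ∧ (∀ W : WeierstrassCurve ℚ, W.even_analyticRank_iff) ∧ (∀ (W : WeierstrassCurve ℚ) (K : Type) [Field K] [NumberField K], Literature.NumberTheory.EllipticCurves.exists_isHeegnerPoint W K)) ∧ Literature.NumberTheory.EllipticCurves.HuShuYin2019.shaAnPair_mul_height_eq_two_zpow_mul_height

/-- item stmt-BirchSwinnertonDyer-19726 · aside · rank 9 · open · by planner
sources: HuShuYin2019
[aside] Hu–Shu–Yin, JLMS 100 (2019) Cor 4.4 / (bsd) display p. 12: the explicit Heegner-point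
L-value identity #Ш_an(E_p)·#Ш_an(E_{3p²}) · ĥ = 2^{2n} · ĥ' for the HSY pair
(`HuShuYin2019.shaAnPair_mul_height_eq_two_zpow_mul_height`, x1b GEN 48 p443765 ACCEPTED
9288db3df34f) — conjunct 2 of PublishedFactsTwoPlus (19724), BY NAME. Banked context (D-0019 aside):
never staffed, not progress, BC6-exempt; filed ONLY so the cite_only head constant is item-stated
(gate5 #15c one rule; staffable remedy); no crux statement / closes / tribunal / tribunal_fit change
intended. -/
@[route_item "route-BirchSwinnertonDyer-SylvesterTwoHeegnerIndex"]
def HuShuYinHeegnerHeightDisplay : Prop :=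
  Literature.NumberTheory.EllipticCurves.HuShuYin2019.shaAnPair_mul_height_eq_two_zpow_mul_height

/-- item stmt-BirchSwinnertonDyer-19921 · aside · rank 9 · open · by operator
sources: GrossZagier1986, Kolyvagin1990
[support] The one PUBLISHED input the halves-glue consumes: Gross–Zagier–Kolyvagin, rank = analytic
rank for analytic rank ≤ 1 with Ш finite (tree named fact
rank_eq_analyticRank_of_analyticRank_le_one; used by bsdp_of_missingPPartAt to turn Miller's last
clause into BSD(E,2)). Carried as a displayed PUB hypothesis; never counted as progress. The further
PRINT of the roads to the two halves (Greenberg Thm-4.1 analogues at a multiplicative prime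
thm41Analogue_charValue_rankZero_numberField_anyPrime / …_split_baseChange_anyPrime, modularity) and
the referee-passed MEMO inputs (Kato ⊗ℚ at a multiplicative 2:
X5.O1.KatoMultiplicativeDivisibilityRat W 2, HOME mult/PROOF-MULT.md RC-2; Greenberg–Stevens at 2:
greenberg_stevens W 2, mult/PROOF-GS2.md RC-4) enter the LINES under the halves (bridge
multiplicativeRankZeroAtTwo_of_muRoad, p409679), not this glue. -/
@[route_item "route-BirchSwinnertonDyer-SylvesterTwoHeegnerIndex"]
def RankEqAnalyticRankLeOne : Prop :=
  Literature.NumberTheory.EllipticCurves.rank_eq_analyticRank_of_analyticRank_le_one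

/-- item stmt-BirchSwinnertonDyer-19232 · assembly · rank 1 · closed · proved by Summit.BirchSwinnertonDyer.BirchSwinnertonDyer.Theorems.sylvesterTwoHeegnerIndex_assembly_proof (prover) · by planner
sources: GrossZagier1986, HuShuYin2019
[assembly] HeegnerIndexLowerAtTwoHSY → HeegnerIndexUpperAtTwoHSY → PublishedFactsTwo → X12.CMAtTwo
(the rung leaf K7t). -/
@[route_item "route-BirchSwinnertonDyer-SylvesterTwoHeegnerIndex"]
def Assembly : Prop :=
  HeegnerIndexLowerAtTwoHSY → HeegnerIndexUpperAtTwoHSY → PublishedFactsTwo → Summit.BirchSwinnertonDyer.Rank1Residual.X12.CMAtTwo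

-- `Assembly` holds: proved by `Summit.BirchSwinnertonDyer.BirchSwinnertonDyer.Theorems.sylvesterTwoHeegnerIndex_assembly_proof` (its module imports this route file, so no `_holds` link can be stated here).

/-! D-0027 §2.1 — DECIDING THEOREM (planner-authored via `route open/edit --closes-file`; by planner-bsd-cm-plan-g19-0 2026-08-26T17:01:57Z):
its hypotheses are this route's items and its conclusion the registered leaf `Summit.BirchSwinnertonDyer.Rank1Residual.X12.CMAtTwo` (rung K7t, D-0061) (glue_lint), and it elaborates with this file. -/

-- E1 closes for K7t after the facts-plus cascade (planner fills nothing here unless the ∧-nesting of PublishedFactsTwoPlus differs):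
@[closes "route-BirchSwinnertonDyer-SylvesterTwoHeegnerIndex"] theorem closes (hlo : HeegnerIndexLowerAtTwoHSYOfFacts) (hupP : HeegnerIndexUpperAtTwoHSYOfFactsPlus)
    (hFP : PublishedFactsTwoPlus) : Summit.BirchSwinnertonDyer.Rank1Residual.X12.CMAtTwo :=
  Summit.BirchSwinnertonDyer.BirchSwinnertonDyer.Rank1Residual.CMRungInputs.cmAtTwo_of_inputs (hlo hFP.1) (hupP hFP) hFP.1

end Summit.BirchSwinnertonDyer.BirchSwinnertonDyer.Theses.SylvesterTwoHeegnerIndex
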